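import Summits.QuantumFields.YangMills.Theorems.BalabanUVNodesN15KingModelPotentialDressedRate
import Summits.QuantumFields.YangMills.Theorems.BalabanUVNodesN15KingModelPotentialDressedNE2

/-!
# BalabanUVNodes ∕ N15 — THE KING MODEL, PART 10d: `NE2PlusUnit` BY NAME FOR KING'S TOWER FULLY DRESSED BY A POTENTIAL, WITH BOTH
# LETTERS DERIVED — the coherence sort `potBg` (part 8c: (3.35) := size, (3.36) := block-spin coherence) now carries the NONPERTURBATIVELY
# dressed one-step covariance kernel `C_v^{(k+1)} − C_v^{(k)}`, `C_v^{(j)} = (Δ^{(max j 1)}_v + aL⁻²Q*Q)⁻¹`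
# (Track A, DAG node N15 = NE2; FAN-OUT v1.1 §N15 s3 «KING-MODEL RUNG … + the one-line statement of what the curved case adds»)

HONEST FRAMING.  Count-neutral kernel bookkeeping (cell `pub-ymgap`, seat `pub-ymgap-dag-n15-d` g8; `--supports stmt-QuantumFields-20292
--as helper` = K3⁗ `SpineGivenEndpointR13Sep`; lineage K3 19676 → K3′ 19908 → K3‴ 19912).  King's `A = 0` SCALAR block-spin tower
([King1986] §2.2 (2.13)–(2.15) p. 653, (4.32)–(4.34) p. 674, Lemma 4.5 (4.38) p. 674) on the King-admissible unit tori `Π ℤ∕(2L^{e+1})` (odd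
`L ≥ 3`, `m² > 0`) dressed NONPERTURBATIVELY by a scalar POTENTIAL TOWER; the potential is a multiplication operator, NOT a gauge field;
nothing here is Bałaban's `Δ^{(k)}(U) − Δ^{(k)}(1)` ∕ `C^{(k)}(Λ; U)`; NE2⁺ for THOSE is NOT PRINTED and not proved; NOT a node discharge;
nothing continuum ∕ ℝ⁴ ∕ OS ∕ mass-gap ∕ Clay.  0 `sorry`, 1 `def` (`kingKerVW`), standard axioms.

THE POINT.  The lineage's unit layer for King's tower dressed by a potential came in three strengths: 6b (abstract perturbation tower, both
letters READ), 8c (first-order dressing `Δ^{(k)} + δΔ^{(k)}[v]`, both letters DERIVED: `ne2PlusUnit_kingV`), 9d (FULL dressing `Δ^{(k)}_v`,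
locality DERIVED by 9c, two-spacing rate READ: `ne2PlusUnit_kingW`).  With part 10c's `fullPert_supRate_kingU` the rate is a theorem, so the
FULL dressing now sits on part 8c's HONEST sort `potBg L s U` ((3.35) := `sup|v_N| ≤ c₃₅α₀`; (3.36) := `sup|v_{L·L^k}(x′) − v_{L^k}(x)| ≤ c₃₅α₀s^k`):
* §1 ★ **`fullPert_letters_kingU`** — THE TWO LETTERS OF THE FULL PERTURBATION AS THEOREMS, in the shape of part 8b's `potTower_letters_kingU`:
  `∃ c, w₁ > 0` with, for every volume exponent and every potential tower of size `≤ w₀ ≤ w₁`, `UniformKernelDecay (fullPert v) tdistT (w₀c) κ′`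
  (9c `uniformKernelDecay_fullPert`) and, for every coherence letter `(ν₀, s ≤ L^{−1∕2})`, `EffectiveOperatorSupRate (fullPert v) (c(w₀ + ν₀))
  (L^{−1∕2})` (10c `fullPert_supRate_kingU`), ONE constant `c`;
* §2 def `kingKerVW` (the fully dressed one-step unit kernel on part 8c's family `kingInstanceV`), `kingKerVW_apply`, `kingKerVW_zero`,
  ★★ **`ne2PlusUnit_kingVW`** — `NE2PlusUnit c35 (kingInstanceV L s) (kingKerVW L a m² s) ⊤ (kingDistV L s)` for every `c₃₅ > 0` and every
  coherence rate `0 ≤ s ≤ L^{−1∕2}`: part 6a's socket `ne2PlusUnit_of_freeLeaves_add` on part 3's free leaves (`kingLeaves_at` at `κ′`,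
  ratio `L^{−1∕2}`) and the two DERIVED letters, window `a₀ := w₁∕c₃₅`; constants `(δ₀, a₀, B₀, θ = L^{−1∕4})` uniform in the index AND the
  potential; `ne2ZeroUnit_kingVW`.
WHAT THE CURVED CASE ADDS (one line): the same two letters for Bałaban's `Δ^{(k)}(U) − Δ^{(k)}(1)` uniformly over the live window
`Reg335∕Reg336 c35 α₀ U` of [B9] (3.35)–(3.36) — a covariant (non-abelian) background in place of a scalar potential; print gives analyticity
in `U` (Thm 3.4) and η-uniformity, never an η-difference.
HONEST SCOPE.  King-admissible tori only; rate `θ = L^{−1∕4}` (`√(L^{−1∕2})`, immaterial for the shape); the window `w₁` depends on `m²` (through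
the Riemann mass of part 10a) but not on `k`, the volume or the potential; scalar potential, `A = 0`; not a discharge.
Locators: [King1986] C. King, CMP **102** (1986) 649–677: (2.13)–(2.15) p. 653, Theorem 3.3 (3.7) p. 658, Prop. 3.8 (3.71) p. 664, Lemma 4.3
(4.18) p. 672, (4.32)–(4.34), Lemma 4.5 (4.38), (4.39) p. 674, (4.40)–(4.41) p. 675; [B9] = [Balaban1985BackgroundPropagators] CMP **99**
(1985): (3.35)–(3.36) p. 396 (slots), Thm 3.4 p. 400, Thm 3.15 (3.187) p. 432 (quantifier template).
-/

noncomputable section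

open scoped BigOperators
open Finset

namespace Summit.QuantumFields.YangMills.BalabanUVNodes.N15.KingModel

open Literature.MathematicalPhysics.QuantumFieldTheory.Balaban1983to89 hiding blockOf
open Literature.MathematicalPhysics.QuantumFieldTheory.Balaban1983to89.T4EtaRate (PairedInstance EtaPairing NE2PlusUnit)
open Literature.MathematicalPhysics.QuantumFieldTheory.Balaban1983to89.T4EtaRateUnitWitness (NE2ZeroUnit ne2ZeroUnit_of_ne2PlusUnit)
open Literature.MathematicalPhysics.QuantumFieldTheory.Balaban1983to89.B4Sect5Proof (latticeConst latticeConst_nonneg)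
open Literature.MathematicalPhysics.QuantumFieldTheory.Balaban1983to89.B5Prop11Plancherel (Tor fine)
open Literature.MathematicalPhysics.QuantumFieldTheory.King1986.Torus (blockOf tdistT tdistT_isPseudoDist tdistT_sumBound aminL aminL_pos CDelU
  CDelU_pos gam0L gam0L_pos kapCT kapCT_pos_le thetaBar)
open Summit.QuantumFields.BalabanUV.T4Continuum.NE2KingTransplant (IsPseudoMetric UniformCoercive UniformCTBound UniformKernelDecay
  EffectiveOperatorSupRate VolumeSum)
open Summit.QuantumFields.YangMills.BalabanUVNodes.N15KingModelRung.Curved (underPtN blockOf_underPtN)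

variable {d : ℕ}

/-! ## §1 The two letters of the full perturbation as theorems, one constant -/

section Letters

open Real

variable (L : ℕ) [NeZero L]

/-- **THE TWO LETTERS OF THE FULL PERTURBATION `E(v) = Δ_v − Δ`, AS THEOREMS, ON KING'S TORI** (the shape of part 8b's `potTower_letters_kingU`
for the first variation): for odd `L ≥ 3`, `a, m² > 0` there are `c, w₁ > 0` such that for every volume exponent `e` and every potential tower `v`
of size `sup|v_N| ≤ w₀ ≤ w₁`: (LOCALITY, 9c) `UniformKernelDecay (fullPert v) tdistT (w₀·c) κ′`; (TWO-SPACING, 10c) for every coherence letter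
`|v_{L·L^k}(x′) − v_{L^k}(x)| ≤ ν₀s^k` (`0 ≤ ν₀`, `0 ≤ s ≤ L^{−1∕2}`), `EffectiveOperatorSupRate (fullPert v) (c·(w₀ + ν₀)) (L^{−1∕2})`.
[cite: King1986, Theorem 3.3 (3.7) p.658, Prop. 3.8 (3.71) p.664, (4.34) p.674, (4.39)–(4.41) p.675] -/
theorem fullPert_letters_kingU (hLodd : Odd L) (hL : 2 ≤ L) {a m2 : ℝ} (ha : 0 < a) (hm : 0 < m2) :
    ∃ c w₁ : ℝ, 0 < c ∧ 0 < w₁ ∧ ∀ (e : ℕ) (v : ∀ N : ℕ, Tor (fine N (kingU d L e)) → ℝ) (w₀ : ℝ),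
      (∀ (N : ℕ) (x : Tor (fine N (kingU d L e))), |v N x| ≤ w₀) → w₀ ≤ w₁ →
      UniformKernelDecay (fullPert a m2 L (kingM d L e) v) (tdistT (kingU d L e)) (w₀ * c) (kapCT (d + 1) a L) ∧
      ∀ (ν₀ s : ℝ), 0 ≤ ν₀ → 0 ≤ s → s ≤ (L : ℝ) ^ (-(1 / 2 : ℝ)) →
        (∀ (k : ℕ), 1 ≤ k → ∀ x' : Tor (fine (L ^ 1 * L ^ k) (kingU d L e)),
            |v (L ^ 1 * L ^ k) x' - v (L ^ k) (underPtN L k 1 (kingU d L e) x')| ≤ ν₀ * s ^ k) →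
        EffectiveOperatorSupRate (fullPert a m2 L (kingM d L e) v) (c * (w₀ + ν₀)) ((L : ℝ) ^ (-(1 / 2 : ℝ))) := by
  obtain ⟨wb, cR, hwb, hcR, HR⟩ := fullPert_supRate_kingU (d := d) L hLodd hL ha hm
  obtain ⟨hCK, hKW, hwbar⟩ := dressedConsts_nonneg (d := d) ha hL
  obtain ⟨hr0, -, -⟩ := rate_facts L hL
  set cL : ℝ := a ^ 2 * ctCK (d + 1) a L ^ 2 * kwSum (d + 1) a L with hcL
  have hcL0 : 0 ≤ cL := by positivity
  refine ⟨max cL cR + 1, min wb (wbarK (d + 1) a L), by positivity, lt_min hwb hwbar, fun e v w₀ hsize hw => ⟨?_, ?_⟩⟩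
  · -- locality: 9c's derived letter, constant `cL·w₀ ≤ w₀·c`
    have hw₀ : 0 ≤ w₀ := (abs_nonneg _).trans (hsize 1 fun _ => 0)
    have l1 := uniformKernelDecay_fullPert (M := kingM d L e) ha hm hL (hw.trans (min_le_right _ _)) hsize
    refine uniformKernelDecay_mono l1 ?_
    calc a ^ 2 * ctCK (d + 1) a L ^ 2 * kwSum (d + 1) a L * w₀ = w₀ * cL := by rw [hcL]; ring
      _ ≤ w₀ * (max cL cR + 1) := mul_le_mul_of_nonneg_left (by linarith [le_max_left cL cR]) hw₀
  · -- two-spacing: 10c, constant `cR ≤ c`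
    intro ν₀ s hν₀ hs0 hs1 hcoh
    have hw₀ : 0 ≤ w₀ := (abs_nonneg _).trans (hsize 1 fun _ => 0)
    have l2 := HR e v w₀ ν₀ s hsize (hw.trans (min_le_left _ _)) hν₀ hs0 hs1 hcoh
    refine effectiveOperatorSupRate_mono hr0.le l2 ?_
    exact mul_le_mul_of_nonneg_right (by linarith [le_max_right cL cR]) (by positivity)

end Letters

/-! ## §2 The socket fires for the full dressing on the coherence sort: `NE2PlusUnit` BY NAME, both letters derived -/

section Socket

open Real

variable (L : ℕ) [NeZero L]

/-- THE FULLY DRESSED UNIT KERNEL on part 8c's family: at index `i` and potential tower `v`, `(y, y′) ↦ C_v^{(k+1)}(y, y′) − C_v^{(k)}(y, y′)`, the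
one-step η-difference of the covariances of King's tower dressed NONPERTURBATIVELY by `v` (part 6b's `kingCovE` at the full perturbation `fullPert v`).
[cite: King1986, Lemma 4.5 (4.38) p.674 (the differenced object, A = 0); Balaban1985BackgroundPropagators, Thm 3.15 (3.187) p.432 (C^{(k)}(Λ;U): shape)] -/
def kingKerVW (a m2 s : ℝ) (i : KingPotIdx d) : B9.SiteKernel (kingInstanceV L s i).gc (kingInstanceV L s i).Bf :=
  ⟨fun v y y' => kingCovE a m2 L (kingM d L i.e) (fullPert a m2 L (kingM d L i.e) v) (i.k + 1) y y'
      - kingCovE a m2 L (kingM d L i.e) (fullPert a m2 L (kingM d L i.e) v) i.k y y'⟩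

variable {L}

/-- The dressed kernel in terms of the fully dressed tower: `C_v^{(j)} = (Δ^{(max j 1)}_{v} + aL⁻²Q*Q)⁻¹` (part 9c's `kingCovE_fullPert`). [folklore] -/
theorem kingKerVW_apply (a m2 s : ℝ) (i : KingPotIdx d) (v : ∀ N : ℕ, Tor (fine N (kingU d L i.e)) → ℝ) (y y' : Tor (kingU d L i.e)) :
    (kingKerVW L a m2 s i).ker v y y'
      = (kingTowerPot a m2 L (kingM d L i.e) v (i.k + 1) + kingBlock a L (kingM d L i.e))⁻¹ y y'
        - (kingTowerPot a m2 L (kingM d L i.e) v i.k + kingBlock a L (kingM d L i.e))⁻¹ y y' := by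
  show kingCovE a m2 L (kingM d L i.e) (fullPert a m2 L (kingM d L i.e) v) (i.k + 1) y y'
      - kingCovE a m2 L (kingM d L i.e) (fullPert a m2 L (kingM d L i.e) v) i.k y y' = _
  rw [kingCovE_fullPert, kingCovE_fullPert]

/-- At the zero tower the dressed kernel is the undressed one-step difference `(Δ^{(k+1)} + B)⁻¹ − (Δ^{(k)} + B)⁻¹` (consistency with parts 3, 6b, 8c, 9d).
[folklore] -/
theorem kingKerVW_zero (a m2 s : ℝ) (i : KingPotIdx d) (y y' : Tor (kingU d L i.e)) :
    (kingKerVW L a m2 s i).ker (fun _ _ => 0) y y'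
      = (kingTower a m2 L (kingM d L i.e) (i.k + 1) + kingBlock a L (kingM d L i.e))⁻¹ y y'
        - (kingTower a m2 L (kingM d L i.e) i.k + kingBlock a L (kingM d L i.e))⁻¹ y y' := by
  show kingCovE a m2 L (kingM d L i.e) (fullPert a m2 L (kingM d L i.e) (fun _ _ => 0)) (i.k + 1) y y'
      - kingCovE a m2 L (kingM d L i.e) (fullPert a m2 L (kingM d L i.e) (fun _ _ => 0)) i.k y y' = _
  rw [fullPert_zero, kingCovE_zero, kingCovE_zero]

variable (L)

/-- **THE SOCKET FIRES FOR KING'S TOWER FULLY DRESSED BY A POTENTIAL — `NE2PlusUnit` BY NAME, BOTH LETTERS DERIVED** (torus dimension `d + 1`,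
odd `L ≥ 3`, `a, m² > 0`, every `c₃₅ > 0`, every coherence rate `0 ≤ s ≤ L^{−1∕2}`): on part 8c's family `kingInstanceV L s` (index = volume
exponent, `k ≥ 1`, shift, free size letter `Msz ≥ 1`; backgrounds = POTENTIAL TOWERS with (3.35) := size, (3.36) := coherence at rate `s`) with the
FULLY dressed one-step unit kernel `kingKerVW` (`C_v^{(k+1)} − C_v^{(k)}`, `C_v^{(j)} = (Δ^{(max j 1)}_v + aL⁻²Q*Q)⁻¹`), `inΛ := ⊤`, `unitDist := tdistT`:
`NE2PlusUnit c35 (kingInstanceV L s) (kingKerVW L a m² s) ⊤ tdistT`.  Mechanism: §1's two letters (THEOREMS: 9c's block Combes–Thomas locality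
and 10c's dressed-minimiser two-spacing rate) at size `c₃₅α₀ ≤ w₁` and coherence `c₃₅α₀·s^k`; part 3's free leaves at `κ′` and ratio `L^{−1∕2}`
(`kingLeaves_at`); window `a₀ := min(w₁, γ₀∕(8·K(κ′∕2)·c))∕c₃₅` keeps the gap `ρ + ρ_B + 2c_EV < γ₀`; part 6a's socket `ne2PlusUnit_of_freeLeaves_add`.
Constants `(δ₀, a₀, B₀, θ)` uniform in the index AND the potential; `θ = L^{−1∕4}`.  HONEST SCOPE: King's `A = 0` scalar tower dressed
nonperturbatively by a scalar potential tower; NOT Bałaban's `C^{(k)}(Λ; U)` nor a gauge-field background; NOT a node discharge; count-neutral.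
[cite: King1986, Lemma 4.5 (4.38) p.674 with (4.33)–(4.34), Theorem 3.3 (3.7) p.658, Prop. 3.8 (3.71) p.664, Lemma 4.3 (4.18) p.672, (4.39) p.674, (4.40)–(4.41) p.675; Balaban1985BackgroundPropagators, Thm 3.15 (3.187) p.432 (quantifier template), (3.35)–(3.36) p.396 (slots)] -/
theorem ne2PlusUnit_kingVW (hLodd : Odd L) (hL : 2 ≤ L) {a m2 : ℝ} (ha : 0 < a) (hm : 0 < m2) {c35 : ℝ} (hc : 0 < c35)
    {s : ℝ} (hs0 : 0 ≤ s) (hs1 : s ≤ (L : ℝ) ^ (-(1 / 2 : ℝ))) :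
    NE2PlusUnit c35 (kingInstanceV (d := d) L s) (kingKerVW L a m2 s) (fun _ _ => True) (kingDistV L s) := by
  obtain ⟨c₁, w₁, hc₁, hw₁, HL⟩ := fullPert_letters_kingU (d := d) L hLodd hL ha hm
  obtain ⟨hr0, hr1, hr2⟩ := rate_facts L hL
  have hamin := aminL_pos ha hL
  have hγ := gam0L_pos (d := d + 1) ha hL
  have hθ := thetaBar_mul_nonneg (a := a) ha hL
  have hCU := CDelU_pos (d := d + 1) ha hamin
  obtain ⟨hκ'0, -⟩ := kapCT_pos_le (d := d + 1) ha hL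
  set κ₈ : ℝ := kapCT (d + 1) a L with hκ₈
  set V₈ : ℝ := latticeConst (d + 1) (κ₈ / 2) with hV₈
  have hV : 0 < V₈ := latticeConst_pos (d + 1) (half_pos hκ'0)
  set γ₀ : ℝ := gam0L (d + 1) a L with hγ₀
  have hρ := kingRho_add_le (dd := d + 1) ha hL
  -- the window: size `c₃₅α₀ ≤ A := min(w₁, γ₀∕(8V₈c₁))`
  set A : ℝ := min w₁ (γ₀ / (8 * V₈ * c₁)) with hA
  have hA0 : 0 < A := lt_min hw₁ (by positivity)
  refine ne2PlusUnit_of_freeLeaves_add (c35 := c35) (pi := kingInstanceV (d := d) L s) (Kd := kingKerVW L a m2 s)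
    (inΛ := fun _ _ => True) (unitDist := kingDistV L s) (m := fun i => Tor (kingU d L i.e)) (a₀ := A / c35)
    (by positivity) (fun _ y => y) (fun i => tdistT (kingU d L i.e)) (fun i => kingTower a m2 L (kingM d L i.e))
    (fun i v => fullPert a m2 L (kingM d L i.e) v) (fun i => kingBlock a L (kingM d L i.e))
    (γ := γ₀) (κ := κ₈) (ρ := kingRho (d + 1) a L) (ρB := kingRhoB (d + 1) a L) (ε := thetaBar a L * a)
    (C₁ := CDelU (d + 1) a (aminL a L)) (V := V₈) (r := (L : ℝ) ^ (-(1 / 2 : ℝ))) (cE := γ₀ / (8 * V₈)) (εE := γ₀ / (4 * V₈))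
    ?_ hκ'0 (by positivity) (by positivity) (by positivity) hV hr0 hr1 (fun i => isPseudoMetric_tdistT (kingU d L i.e)) (fun _ _ _ => le_rfl)
    (fun i => kingLeaves_at L ha hm hL (kingM d L i.e) hκ'0 le_rfl hr2) fun i α₀ hα hMa v h335 h336 => ?_
  · -- the gap `ρ + ρ_B + 2c_EV < γ₀`
    have e1 : 2 * (γ₀ / (8 * V₈) * V₈) = γ₀ / 4 := by field_simp; ring
    rw [e1]
    linarith
  · -- the letters at a regular potential inside the window
    have hcα : 0 ≤ c35 * α₀ := by positivity
    have hαA : c35 * α₀ ≤ A := by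
      have h1 : α₀ ≤ i.Msz * α₀ := le_mul_of_one_le_left hα.le i.one_le_Msz
      have h2 : α₀ ≤ A / c35 := h1.trans hMa
      rw [le_div_iff₀ hc] at h2
      linarith
    have hαw₁ : c35 * α₀ ≤ w₁ := hαA.trans (min_le_left _ _)
    have hαg : c35 * α₀ ≤ γ₀ / (8 * V₈ * c₁) := hαA.trans (min_le_right _ _)
    obtain ⟨l1, l2'⟩ := HL i.e v (c35 * α₀) h335 hαw₁
    have l2 := l2' (c35 * α₀) s hcα hs0 hs1 h336
    refine ⟨?_, ?_, fun y y' => rfl⟩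
    · have hcE : c35 * α₀ * c₁ ≤ γ₀ / (8 * V₈) := by
        rw [le_div_iff₀ (by positivity)] at hαg
        rw [le_div_iff₀ (by positivity)]
        nlinarith
      exact uniformKernelDecay_mono l1 hcE
    · have hεE : c₁ * (c35 * α₀ + c35 * α₀) ≤ γ₀ / (4 * V₈) := by
        rw [le_div_iff₀ (by positivity)] at hαg
        rw [le_div_iff₀ (by positivity)]
        nlinarith
      exact effectiveOperatorSupRate_mono hr0.le l2 hεE

/-- … and the trivial-background unit layer `NE2ZeroUnit` of the fully dressed family on the coherence sort (the zero tower is regular at every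
size). [cite: King1986, Lemma 4.5 (4.38) p.674] -/
theorem ne2ZeroUnit_kingVW (hLodd : Odd L) (hL : 2 ≤ L) {a m2 : ℝ} (ha : 0 < a) (hm : 0 < m2) {s : ℝ} (hs0 : 0 ≤ s)
    (hs1 : s ≤ (L : ℝ) ^ (-(1 / 2 : ℝ))) :
    NE2ZeroUnit (kingInstanceV (d := d) L s) (kingKerVW L a m2 s) (fun _ _ => True) (kingDistV L s) := by
  refine ne2ZeroUnit_of_ne2PlusUnit (c35 := 1) (fun i => lt_of_lt_of_le one_pos i.one_le_Msz) (fun i α₀ hα => ?_) (fun i α₀ hα => ?_)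
    (ne2PlusUnit_kingVW L hLodd hL ha hm one_pos hs0 hs1)
  · exact (potBg_reg_const L hs0 (kingU d L i.e) (t := 0) (by rw [abs_zero]; positivity)).1
  · exact (potBg_reg_const L hs0 (kingU d L i.e) (t := 0) (by rw [abs_zero]; positivity)).2

end Socket

end Summit.QuantumFields.YangMills.BalabanUVNodes.N15.KingModel

end
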